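import Summits.PneNP.PneNP.Theorems.SfmBlMachineTrace

/-!
# Line «sfm-bl», MACHINE LAYER M3b (part 1): the enumerated leg-walks as functions (stmt-PneNP-20523)

FRONTIER F-N1c; nothing here bears on P vs NP.

Towards identifying the machine's `traceSum` (M3a, `SfmBlMachineTrace`) with the right-hand side of p3's
`SfmBl.sum_cylinder_trace_pow_eq_parts` (a sum over PAIRS OF FUNCTIONS `L, L' : Fin (q+1) → legs`), this file
re-describes the enumerated alternating sequences as FUNCTIONS in forward order: `s ∈ aseqsU rl t` iff
`s = (List.ofFn g).reverse` for a (unique) `g : Fin (t+1) → PLeg` with all values in `rl` and the alternating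
LINKS `Link p (g p) (g (p+1))` (left piece shared after even positions, right piece after odd positions) —
`mem_aseqsU_iff_ofFn`; and proves the enumeration has NO DUPLICATES (`nodup_aseqsU`, for `rl` without duplicates),
so that list sums over it are `Finset` sums (`sum_map_eq_sum_toFinset`).  Part 2 (pairs `(L, L')`, the contribution
in `μ`-form) builds on this.
-/

set_option linter.dupNamespace false -- `Summit.PneNP.PneNP.…`: summit = sub-problem name (D-0017 single-conjunct layout)

namespace Summit.PneNP.PneNP.Theorems.SfmBlMachine

open Literature.Computability.Complexity

/-- The alternating LINK after forward position `p`: even `p` — same LEFT piece; odd `p` — same RIGHT piece. -/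
def Link (p : ℕ) (x y : PLeg) : Prop := if p % 2 = 0 then labL y = labL x else labR y = labR x

/-- Forward admissibility of `g : Fin (t+1) → PLeg`: values in `rl`, consecutive values linked. -/
def FwdAdm (rl : List PLeg) (t : ℕ) (g : Fin (t + 1) → PLeg) : Prop :=
  (∀ p, g p ∈ rl) ∧ ∀ (p : ℕ) (h : p + 1 < t + 1), Link p (g ⟨p, by omega⟩) (g ⟨p + 1, h⟩)

/-- Restriction of a forward-admissible function to the first `t + 1` positions. -/
theorem fwdAdm_castSucc {rl : List PLeg} {t : ℕ} {g : Fin (t + 2) → PLeg} (h : FwdAdm rl (t + 1) g) :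
    FwdAdm rl t (fun p => g p.castSucc) := by
  refine ⟨fun p => h.1 _, fun p hp => ?_⟩
  have := h.2 p (by omega)
  simpa [Fin.castSucc_mk] using this

/-- `List.ofFn` of a `Fin.snoc` reversed: the new value in front. -/
theorem reverse_ofFn_snoc {t : ℕ} (g : Fin (t + 1) → PLeg) (y : PLeg) :
    (List.ofFn (Fin.snoc g y : Fin (t + 2) → PLeg)).reverse = y :: (List.ofFn g).reverse := by
  rw [List.ofFn_succ', Fin.snoc_last]
  simp only [Fin.snoc_castSucc, List.concat_eq_append, List.reverse_append, List.reverse_cons,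
    List.reverse_nil, List.nil_append, List.singleton_append]

/-- The head of a reversed `List.ofFn` is the last value. -/
theorem getD_reverse_ofFn_zero {t : ℕ} (g : Fin (t + 1) → PLeg) :
    (List.ofFn g).reverse.getD 0 dleg = g (Fin.last t) := by
  rw [List.ofFn_succ', List.concat_eq_append, List.reverse_append]
  simp

/-- **The enumerated sequences with `t + 1` legs are the reversed value lists of the forward-admissible functions.** -/
theorem mem_aseqsU_iff_ofFn (rl : List PLeg) : ∀ (t : ℕ) (s : List PLeg),
    s ∈ aseqsU rl t ↔ ∃ g : Fin (t + 1) → PLeg, FwdAdm rl t g ∧ s = (List.ofFn g).reverse := by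
  intro t
  induction t with
  | zero =>
    intro s
    simp only [aseqsU, aseqs0, List.mem_map]
    constructor
    · rintro ⟨x, hx, rfl⟩
      refine ⟨fun _ => x, ⟨fun _ => hx, fun p hp => by omega⟩, ?_⟩
      simp [List.ofFn_succ]
    · rintro ⟨g, hg, rfl⟩
      exact ⟨g 0, hg.1 0, by simp [List.ofFn_succ]⟩
  | succ t ih =>
    intro s
    simp only [aseqsU, astep, List.mem_flatten, List.mem_map]
    constructor
    · rintro ⟨l, ⟨s', hs', rfl⟩, hs⟩
      obtain ⟨g', hg', rfl⟩ := (ih s').1 hs'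
      unfold aext at hs
      rw [List.length_reverse, List.length_ofFn, getD_reverse_ofFn_zero] at hs
      have key : ∀ y, y ∈ rl → Link t (g' (Fin.last t)) y →
          ∃ g : Fin (t + 1 + 1) → PLeg, FwdAdm rl (t + 1) g ∧ y :: (List.ofFn g').reverse = (List.ofFn g).reverse := by
        intro y hy hlink
        refine ⟨Fin.snoc g' y, ⟨fun p => ?_, fun p hp => ?_⟩, (reverse_ofFn_snoc g' y).symm⟩
        · refine Fin.lastCases ?_ (fun i => ?_) p
          · rw [Fin.snoc_last]; exact hy
          · rw [Fin.snoc_castSucc]; exact hg'.1 i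
        · by_cases hpt : p + 1 = t + 1
          · have hp' : p = t := by omega
            subst hp'
            have e1 : (Fin.snoc g' y : Fin (p + 2) → PLeg) ⟨p, by omega⟩ = g' (Fin.last p) := by
              rw [show (⟨p, by omega⟩ : Fin (p + 2)) = (Fin.last p).castSucc from rfl, Fin.snoc_castSucc]
            have e2 : (Fin.snoc g' y : Fin (p + 2) → PLeg) ⟨p + 1, hp⟩ = y := by
              rw [show (⟨p + 1, hp⟩ : Fin (p + 2)) = Fin.last (p + 1) from rfl, Fin.snoc_last]
            rw [e1, e2]; exact hlink
          · have hlt : p + 1 < t + 1 := by omega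
            have e1 : (Fin.snoc g' y : Fin (t + 2) → PLeg) ⟨p, by omega⟩ = g' ⟨p, by omega⟩ := by
              rw [show (⟨p, by omega⟩ : Fin (t + 2)) = (⟨p, by omega⟩ : Fin (t + 1)).castSucc from rfl,
                Fin.snoc_castSucc]
            have e2 : (Fin.snoc g' y : Fin (t + 2) → PLeg) ⟨p + 1, hp⟩ = g' ⟨p + 1, hlt⟩ := by
              rw [show (⟨p + 1, hp⟩ : Fin (t + 2)) = (⟨p + 1, hlt⟩ : Fin (t + 1)).castSucc from rfl,
                Fin.snoc_castSucc]
            rw [e1, e2]; exact hg'.2 p hlt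
      have ht : (t + 1) % 2 = 1 ↔ t % 2 = 0 := by omega
      split_ifs at hs with hpar
      · obtain ⟨y, hy, rfl⟩ := List.mem_map.1 hs
        rw [List.mem_filter, decide_eq_true_eq] at hy
        exact key y hy.1 (by unfold Link; rw [if_pos (ht.1 hpar)]; exact hy.2)
      · obtain ⟨y, hy, rfl⟩ := List.mem_map.1 hs
        rw [List.mem_filter, decide_eq_true_eq] at hy
        exact key y hy.1 (by unfold Link; rw [if_neg (fun h => hpar (ht.2 h))]; exact hy.2)
    · rintro ⟨g, hg, rfl⟩
      let g' : Fin (t + 1) → PLeg := fun p => g p.castSucc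
      have hg' : FwdAdm rl t g' := fwdAdm_castSucc hg
      have hsnoc : (Fin.snoc g' (g (Fin.last (t + 1))) : Fin (t + 2) → PLeg) = g := by
        ext p <;> refine Fin.lastCases ?_ (fun i => ?_) p <;> simp [g']
      refine ⟨aext rl (List.ofFn g').reverse, ⟨(List.ofFn g').reverse, (ih _).2 ⟨g', hg', rfl⟩, rfl⟩, ?_⟩
      have hrev : (List.ofFn g).reverse = g (Fin.last (t + 1)) :: (List.ofFn g').reverse := by
        rw [← hsnoc, reverse_ofFn_snoc, hsnoc]
      have hlink := hg.2 t (by omega)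
      have e1 : g ⟨t, by omega⟩ = g' (Fin.last t) := rfl
      have e2 : g ⟨t + 1, by omega⟩ = g (Fin.last (t + 1)) := rfl
      rw [e1, e2] at hlink
      unfold aext
      rw [List.length_reverse, List.length_ofFn, getD_reverse_ofFn_zero, hrev]
      have ht : (t + 1) % 2 = 1 ↔ t % 2 = 0 := by omega
      unfold Link at hlink
      split_ifs with hpar
      · rw [if_pos (ht.1 hpar)] at hlink
        exact List.mem_map.2 ⟨_, List.mem_filter.2 ⟨hg.1 _, by rw [decide_eq_true_eq]; exact hlink⟩, rfl⟩
      · rw [if_neg (fun h => hpar (ht.2 h))] at hlink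
        exact List.mem_map.2 ⟨_, List.mem_filter.2 ⟨hg.1 _, by rw [decide_eq_true_eq]; exact hlink⟩, rfl⟩

/-! ## No duplicates -/

/-- Every extension of `s` is `s` with one more leg in front. -/
theorem exists_eq_cons_of_mem_aext {rl : List PLeg} {s z : List PLeg} (h : z ∈ aext rl s) : ∃ y, z = y :: s := by
  unfold aext at h
  split_ifs at h
  all_goals
    obtain ⟨y, _, rfl⟩ := List.mem_map.1 h
    exact ⟨y, rfl⟩

/-- The extensions of one sequence have no duplicates (for `rl` without duplicates). -/
theorem nodup_aext {rl : List PLeg} (hrl : rl.Nodup) (s : List PLeg) : (aext rl s).Nodup := by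
  unfold aext
  split_ifs
  all_goals
    exact (hrl.filter _).map fun a b h => List.head_eq_of_cons_eq h

/-- **The enumeration has no duplicates** (for remainder legs without duplicates). -/
theorem nodup_aseqsU {rl : List PLeg} (hrl : rl.Nodup) : ∀ t, (aseqsU rl t).Nodup := by
  intro t
  induction t with
  | zero =>
    unfold aseqsU aseqs0
    exact hrl.map fun a b h => by simpa using h
  | succ t ih =>
    show (astep rl (aseqsU rl t)).Nodup
    unfold astep
    rw [List.nodup_flatten]
    refine ⟨fun l hl => ?_, ?_⟩
    · obtain ⟨s, _, rfl⟩ := List.mem_map.1 hl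
      exact nodup_aext hrl s
    · rw [List.pairwise_map]
      refine ih.imp_of_mem ?_
      intro s₁ s₂ _ _ hne z hz₁ hz₂
      obtain ⟨y₁, rfl⟩ := exists_eq_cons_of_mem_aext hz₁
      obtain ⟨y₂, h₂⟩ := exists_eq_cons_of_mem_aext hz₂
      exact hne (List.tail_eq_of_cons_eq h₂)

/-- The second components of a `zip` form a sublist of the second list. -/
theorem map_snd_zip_sublist {α β : Type} : ∀ (l₁ : List α) (l₂ : List β), List.Sublist ((l₁.zip l₂).map Prod.snd) l₂
  | [], l₂ => by simp
  | _ :: _, [] => by simp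
  | a :: as, b :: bs => by
    rw [List.zip_cons_cons, List.map_cons]
    exact (map_snd_zip_sublist as bs).cons_cons b

/-- The remainder legs of a duplicate-free pieced-leg list have no duplicates. -/
theorem nodup_rlegs {plegs : List PLeg} (h : plegs.Nodup) (labels : List ℕ) : (rlegs plegs labels).Nodup := by
  unfold rlegs
  have h1 : List.Sublist (((labels.zip plegs).filter fun q => decide (q.1 = 0)).map Prod.snd)
      ((labels.zip plegs).map Prod.snd) := (List.filter_sublist).map Prod.snd
  exact h.sublist (h1.trans (map_snd_zip_sublist labels plegs))

/-- The pieced legs of M1 have no duplicates (leg `i` carries `(i / 3, i % 3)`). -/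
theorem nodup_pieceLegs (L : ℕ) (trips : List (ℕ × ℕ × ℕ)) : (pieceLegs L trips).Nodup := by
  unfold pieceLegs
  refine (List.nodup_range).map fun i i' h => ?_
  simp only [pleg, Prod.mk.injEq] at h
  omega

/-! ## The contribution in `μ`-form -/

section Contrib

/-- `freeEven`: every output `≥ k` occurs an even number of times. -/
theorem freeEven_iff (k : ℕ) (os : List ℕ) :
    freeEven k os = true ↔ ∀ i, k ≤ i → os.count i % 2 = 0 := by
  unfold freeEven
  rw [List.all_eq_true]
  constructor
  · intro h i hi
    by_cases hmem : i ∈ os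
    · have := h i hmem
      simp only [Bool.or_eq_true, decide_eq_true_eq] at this
      rcases this with h1 | h2
      · omega
      · exact h2
    · rw [List.count_eq_zero_of_not_mem hmem]
  · intro h o ho
    simp only [Bool.or_eq_true, decide_eq_true_eq]
    by_cases hk : o < k
    · exact Or.inl hk
    · exact Or.inr (h o (by omega))

/-- The length of a filtered list as a sum of counts over the values kept. -/
theorem length_filter_eq_sum_count (p : ℕ → Bool) (os : List ℕ) (S : Finset ℕ)
    (hS : ∀ o ∈ os, p o = true → o ∈ S) :
    (os.filter p).length = ∑ i ∈ S.filter (fun i => p i = true), os.count i := by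
  classical
  induction os with
  | nil => simp
  | cons a os ih =>
    have ih' := ih (fun o ho hp => hS o (List.mem_cons_of_mem _ ho) hp)
    rw [List.filter_cons]
    simp only [List.count_cons]
    rw [Finset.sum_add_distrib, ← ih']
    by_cases hp : p a = true
    · rw [if_pos hp, List.length_cons]
      have ha : a ∈ S.filter (fun i => p i = true) := Finset.mem_filter.2 ⟨hS a (by simp) hp, hp⟩
      rw [Finset.sum_eq_single_of_mem a ha (fun b _ hb => by simp [Ne.symm hb])]
      simp
    · rw [if_neg hp]
      have : ∑ x ∈ S.filter (fun i => p i = true), (if (a == x) = true then 1 else 0) = 0 := by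
        refine Finset.sum_eq_zero fun x hx => ?_
        rw [Finset.mem_filter] at hx
        have : a ≠ x := fun h => hp (h ▸ hx.2)
        simp [this]
      rw [this, add_zero]

/-- `sgnPar`: the parity of the total number of uses of the fixed outputs `i < k` with `T₀ i = true`. -/
theorem sgnPar_eq (k : ℕ) (T0 : List Bool) (os : List ℕ) :
    sgnPar k T0 os = (∑ i ∈ (Finset.range k).filter (fun i => T0.getD i false = true), os.count i) % 2 := by
  unfold sgnPar
  rw [length_filter_eq_sum_count _ os (Finset.range k) (fun o _ hp => by
    simp only [Bool.and_eq_true, decide_eq_true_eq] at hp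
    exact Finset.mem_range.2 hp.1)]
  congr 2
  ext i
  simp only [Finset.mem_filter, Finset.mem_range, Bool.and_eq_true, decide_eq_true_eq]
  tauto

open Classical in
/-- **`contrib` in `μ`-form**: `0` unless every free output is used an even number of times, else `± pw` with the
sign `(−1)^{Σ_{i<k, T₀ i} μ i}` (classical `if` over the infinitely many output indices; only those `< m` matter). -/
theorem contrib_eq (k : ℕ) (T0 : List Bool) (pw : ℤ) (s : List PLeg) :
    contrib k T0 pw s
      = if (∀ i, k ≤ i → (outs s).count i % 2 = 0) then
          (-1 : ℤ) ^ (∑ i ∈ (Finset.range k).filter (fun i => T0.getD i false = true), (outs s).count i) * pw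
        else 0 := by
  unfold contrib
  by_cases h : freeEven k (outs s) = true
  · rw [if_pos h, if_pos ((freeEven_iff k (outs s)).1 h), sgnPar_eq]
    rcases Nat.even_or_odd (∑ i ∈ (Finset.range k).filter (fun i => T0.getD i false = true), (outs s).count i)
      with he | ho
    · rw [if_pos (Nat.even_iff.1 he), he.neg_one_pow, one_mul]
    · rw [if_neg (by rw [Nat.odd_iff.1 ho]; decide), ho.neg_one_pow]; ring
  · rw [if_neg h, if_neg (fun h' => h ((freeEven_iff k (outs s)).2 h'))]

end Contrib

end Summit.PneNP.PneNP.Theorems.SfmBlMachine
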